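import Summits.CriticalPhenomena.PercolationContinuityZ3.Theorems.PercNearOneGluingNoHeavyLowerTailSahiLatinFunctionals

/-!
# `NoHeavyLowerTail` (crux stmt-CriticalPhenomena-4575), Sahi programme (prim-master-conj gen 45): AXIS SECTIONS of subsets of
# `[3]^{Option κ}` and the ONE-AXIS LETTER EXPANSION of the Latin functionals `S1`, `latinPairs`, `latinTriples` and of the kernel `κ`

Support file (`--supports stmt-CriticalPhenomena-4575`; toolkit).  Memo `run/shared/lean/prim/prim-l12/FROM-prim-master-conj-g45-*.md`,
gen-44 memo §7 (blueprint "File A").  Nothing here is specific to percolation; nothing is asserted about the crux.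

THE MATHEMATICS.  Single out one axis by taking the index type `Option κ`: a point of `[3]^{Option κ}` is a level `l ∈ [3]` on the axis `none`
glued to a point `x' ∈ [3]^κ` (`glue l x'`), and a finite set `s` has the three SECTIONS `sec s l = {x' : glue l x' ∈ s}` (`l = 0,1,2`),
nested `sec s 0 ⊆ sec s 1 ⊆ sec s 2` when `s` is an up-set (`sec_mono`), each an up-set (`isUpperSet_sec`).  A Latin triple of
`[3]^{Option κ}` is a permutation `τ` of the three levels on the axis `none` times a Latin triple of `[3]^κ` (`sum_lperm_option`), so every
Latin functional expands over the six LETTERS `τ ∈ S₃`: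
* `S1_option : S1 s = 2·Σ_l S1 (sec s l)`,
* `latinPairs_option : latinPairs s t = Σ_τ latinPairs (sec s (τ0)) (sec t (τ1))`,
* `latinTriples_option : latinTriples s t v = Σ_τ latinTriples (sec s (τ0)) (sec t (τ1)) (sec v (τ2))`,
* **`kappa_option`** (the letter expansion of the kernel, all `κ`, arbitrary finsets):
  `κ(a,b,c) = Σ_τ [2·S1(a_{τ0}∩b_{τ0}∩c_{τ0}) − L(a_{τ0}, b_{τ1}∩c_{τ1}) − L(b_{τ0}, a_{τ1}∩c_{τ1}) − L(c_{τ0}, a_{τ1}∩b_{τ1}) + L₃(a_{τ0},b_{τ1},c_{τ2})]`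
  (functionals in dimension `κ`; `x_l = sec x l`), together with `sum_perm3` (a sum over `S₃` is the six explicit terms) for evaluation.
Everything here is proved; axioms standard. [this work]
-/

namespace Summit.CriticalPhenomena.PercolationContinuityZ3.Theorems.SahiLatin

open Finset

variable {κ : Type*} [Fintype κ] [DecidableEq κ]

/-! ## §1  Gluing a level on the distinguished axis; sections -/

/-- The point of `[3]^{Option κ}` with level `l` on the axis `none` and coordinates `x'` on the axes `some k`. [this work] -/
def glue (l : Fin 3) (x' : Pt κ) : Pt (Option κ) := fun o => Option.elim o l x'

omit [Fintype κ] [DecidableEq κ] in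
/-- The `none`-coordinate of a glued point. [this work] -/
@[simp] theorem glue_none (l : Fin 3) (x' : Pt κ) : glue l x' none = l := rfl

omit [Fintype κ] [DecidableEq κ] in
/-- The `some k`-coordinate of a glued point. [this work] -/
@[simp] theorem glue_some (l : Fin 3) (x' : Pt κ) (k : κ) : glue l x' (some k) = x' k := rfl

omit [Fintype κ] [DecidableEq κ] in
/-- Every point is glued from its `none`-level and its restriction. [this work] -/
theorem glue_eta (x : Pt (Option κ)) : glue (x none) (fun k => x (some k)) = x := by
  funext o; cases o <;> rfl

omit [Fintype κ] [DecidableEq κ] in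
/-- `glue` is injective in the pair (level, restriction). [this work] -/
theorem glue_inj {l l' : Fin 3} {x y : Pt κ} (h : glue l x = glue l' y) : l = l' ∧ x = y :=
  ⟨by simpa using congrFun h none, funext fun k => by simpa using congrFun h (some k)⟩

omit [Fintype κ] [DecidableEq κ] in
/-- Order between glued points is the product order. [this work] -/
theorem glue_le_glue_iff {l l' : Fin 3} {x y : Pt κ} : glue l x ≤ glue l' y ↔ l ≤ l' ∧ x ≤ y := by
  constructor
  · intro h
    exact ⟨by simpa using h none, fun k => by simpa using h (some k)⟩
  · rintro ⟨hl, hx⟩ o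
    cases o with
    | none => simpa using hl
    | some k => simpa using hx k

/-- The SECTION of `s` at level `l` of the axis `none`: `{x' : glue l x' ∈ s}`. [this work] -/
def sec (s : Finset (Pt (Option κ))) (l : Fin 3) : Finset (Pt κ) := univ.filter fun x' => glue l x' ∈ s

/-- Membership in a section. [this work] -/
@[simp] theorem mem_sec {s : Finset (Pt (Option κ))} {l : Fin 3} {x' : Pt κ} : x' ∈ sec s l ↔ glue l x' ∈ s := by
  simp [sec]

/-- The indicator of `s` at a glued point is the indicator of the section. [this work] -/
theorem ind_glue (s : Finset (Pt (Option κ))) (l : Fin 3) (x' : Pt κ) : ind s (glue l x') = ind (sec s l) x' := by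
  by_cases h : glue l x' ∈ s
  · rw [ind_of_mem h, ind_of_mem (mem_sec.2 h)]
  · rw [ind_of_not_mem h, ind_of_not_mem (fun h' => h (mem_sec.1 h'))]

/-- Sections commute with intersection. [this work] -/
theorem sec_inter (s t : Finset (Pt (Option κ))) (l : Fin 3) : sec (s ∩ t) l = sec s l ∩ sec t l := by
  ext x'; simp [mem_inter]

/-- Sections of `univ`. [this work] -/
@[simp] theorem sec_univ (l : Fin 3) : sec (univ : Finset (Pt (Option κ))) l = univ := by
  ext x'; simp

/-- Sections of `∅`. [this work] -/
@[simp] theorem sec_empty (l : Fin 3) : sec (∅ : Finset (Pt (Option κ))) l = ∅ := by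
  ext x'; simp

/-- Sections of an up-set are up-sets. [this work] -/
theorem isUpperSet_sec {s : Finset (Pt (Option κ))} (hs : IsUpperSet (s : Set (Pt (Option κ)))) (l : Fin 3) :
    IsUpperSet ((sec s l : Finset (Pt κ)) : Set (Pt κ)) := by
  intro x y hxy hx
  rw [Finset.mem_coe, mem_sec] at hx ⊢
  exact hs (glue_le_glue_iff.2 ⟨le_rfl, hxy⟩) hx

/-- Sections of an up-set are nested along the levels. [this work] -/
theorem sec_mono {s : Finset (Pt (Option κ))} (hs : IsUpperSet (s : Set (Pt (Option κ)))) {l l' : Fin 3} (h : l ≤ l') :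
    sec s l ⊆ sec s l' := by
  intro x' hx
  rw [mem_sec] at hx ⊢
  exact hs (glue_le_glue_iff.2 ⟨h, le_rfl⟩) hx

/-- The cardinality of a set is the sum of the cardinalities of its three sections. [this work] -/
theorem card_eq_sum_card_sec (s : Finset (Pt (Option κ))) : s.card = ∑ l : Fin 3, (sec s l).card := by
  have e : s.card = ((univ : Finset (Fin 3 × Pt κ)).filter fun p => glue p.1 p.2 ∈ s).card := by
    refine (card_nbij (fun p : Fin 3 × Pt κ => glue p.1 p.2) (fun p hp => (mem_filter.1 hp).2) ?_ ?_).symm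
    · intro p _ q _ h
      obtain ⟨h1, h2⟩ := glue_inj h
      exact Prod.ext h1 h2
    · intro x hx
      exact ⟨(x none, fun k => x (some k)), by simpa [glue_eta] using hx, glue_eta x⟩
  rw [e, card_filter, Fintype.sum_prod_type]
  refine sum_congr rfl fun l _ => ?_
  rw [sec, card_filter]

/-! ## §2  Latin triples of `[3]^{Option κ}` = (letter on the axis `none`) × (Latin triple of `[3]^κ`) -/

omit [Fintype κ] [DecidableEq κ] in
/-- The points of a Latin triple of `[3]^{Option κ}` are glued from the letter `ρ none` and the Latin triple `ρ ∘ some`. [this work] -/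
theorem lpt_option (ρ : LPerm (Option κ)) (j : Fin 3) : lpt ρ j = glue (ρ none j) (lpt (fun k => ρ (some k)) j) := by
  funext o; cases o <;> rfl

/-- **A Latin sum over `[3]^{Option κ}` is a sum over the six letters of Latin sums over `[3]^κ`.** [this work] -/
theorem sum_lperm_option (F : Pt (Option κ) → Pt (Option κ) → Pt (Option κ) → ℤ) :
    ∑ ρ : LPerm (Option κ), F (lpt ρ 0) (lpt ρ 1) (lpt ρ 2) =
      ∑ τ : Equiv.Perm (Fin 3), ∑ ρ' : LPerm κ,
        F (glue (τ 0) (lpt ρ' 0)) (glue (τ 1) (lpt ρ' 1)) (glue (τ 2) (lpt ρ' 2)) := by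
  rw [← Fintype.sum_prod_type']
  rw [← (Equiv.piOptionEquivProd (β := fun _ : Option κ => Equiv.Perm (Fin 3))).symm.sum_comp]
  refine Fintype.sum_congr _ _ fun p => ?_
  rcases p with ⟨τ, ρ'⟩
  have h : ∀ j, lpt ((Equiv.piOptionEquivProd (β := fun _ : Option κ => Equiv.Perm (Fin 3))).symm (τ, ρ')) j =
      glue (τ j) (lpt ρ' j) := fun j => by
    funext o; cases o <;> rfl
  rw [h 0, h 1, h 2]

/-- **A sum over `S₃` is its six terms.** [this work] -/
theorem sum_perm3 (g : Fin 3 → Fin 3 → Fin 3 → ℤ) :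
    ∑ τ : Equiv.Perm (Fin 3), g (τ 0) (τ 1) (τ 2) =
      g 0 1 2 + g 0 2 1 + g 1 0 2 + g 1 2 0 + g 2 0 1 + g 2 1 0 := by
  have h1 : ∀ τ : Equiv.Perm (Fin 3), g (τ 0) (τ 1) (τ 2) = g (τ 0) (τ 1) (-(τ 0 + τ 1)) := fun τ => by
    rw [perm_apply_two]
  have hinj : Set.InjOn (fun τ : Equiv.Perm (Fin 3) => (τ 0, τ 1)) (univ : Finset (Equiv.Perm (Fin 3))) :=
    fun σ _ τ _ h => by
      simp only [Prod.mk.injEq] at h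
      exact perm_eq_of_apply01 σ τ h.1 h.2
  have himg : (univ : Finset (Equiv.Perm (Fin 3))).image (fun τ => (τ 0, τ 1)) =
      univ.filter (fun p : Fin 3 × Fin 3 => p.2 ≠ p.1) := by
    ext ⟨i, j⟩
    simp only [mem_image, mem_univ, true_and, mem_filter, Prod.mk.injEq]
    constructor
    · rintro ⟨τ, rfl, rfl⟩
      exact fun h => absurd (τ.injective h) (by decide)
    · intro h
      obtain ⟨σ, h0, h1'⟩ := exists_perm_apply01 i j h
      exact ⟨σ, h0, h1'⟩
  have e : ∑ τ : Equiv.Perm (Fin 3), g (τ 0) (τ 1) (τ 2) =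
      ∑ p ∈ (univ : Finset (Equiv.Perm (Fin 3))).image (fun τ => (τ 0, τ 1)), g p.1 p.2 (-(p.1 + p.2)) := by
    rw [sum_image hinj]
    exact sum_congr rfl fun τ _ => h1 τ
  rw [e, himg, sum_filter, Fintype.sum_prod_type]
  simp only [Fin.sum_univ_three, Fin.isValue]
  have e01 : (-((0 : Fin 3) + 1) : Fin 3) = 2 := by decide
  have e02 : (-((0 : Fin 3) + 2) : Fin 3) = 1 := by decide
  have e10 : (-((1 : Fin 3) + 0) : Fin 3) = 2 := by decide
  have e12 : (-((1 : Fin 3) + 2) : Fin 3) = 0 := by decide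
  have e20 : (-((2 : Fin 3) + 0) : Fin 3) = 1 := by decide
  have e21 : (-((2 : Fin 3) + 1) : Fin 3) = 0 := by decide
  simp only [e01, e02, e10, e12, e20, e21, ne_eq, not_true_eq_false, if_false,
    show ((1 : Fin 3) = 0) = False from by simp, show ((2 : Fin 3) = 0) = False from by simp,
    show ((0 : Fin 3) = 1) = False from by simp, show ((2 : Fin 3) = 1) = False from by simp,
    show ((0 : Fin 3) = 2) = False from by simp, show ((1 : Fin 3) = 2) = False from by simp,
    not_false_eq_true, if_true]
  ring

/-! ## §3  Letter expansions of the Latin functionals -/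

/-- `S1` of a set over `[3]^{Option κ}`: `S1 s = 2·Σ_l S1 (sec s l)`. [this work] -/
theorem S1_option (s : Finset (Pt (Option κ))) : S1 s = 2 * ∑ l : Fin 3, S1 (sec s l) := by
  unfold S1
  rw [sum_lperm_option (fun x _ _ => ind s x)]
  simp only [ind_glue]
  rw [sum_perm3 (fun i _ _ => ∑ ρ' : LPerm κ, ind (sec s i) (lpt ρ' 0))]
  simp only [Fin.sum_univ_three]
  ring

/-- `latinPairs` over `[3]^{Option κ}` expands over the letters. [this work] -/
theorem latinPairs_option (s t : Finset (Pt (Option κ))) :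
    latinPairs s t = ∑ τ : Equiv.Perm (Fin 3), latinPairs (sec s (τ 0)) (sec t (τ 1)) := by
  unfold latinPairs
  rw [sum_lperm_option (fun x y _ => ind s x * ind t y)]
  simp only [ind_glue]

/-- `latinTriples` over `[3]^{Option κ}` expands over the letters. [this work] -/
theorem latinTriples_option (s t v : Finset (Pt (Option κ))) :
    latinTriples s t v = ∑ τ : Equiv.Perm (Fin 3), latinTriples (sec s (τ 0)) (sec t (τ 1)) (sec v (τ 2)) := by
  unfold latinTriples
  rw [sum_lperm_option (fun x y z => ind s x * ind t y * ind v z)]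
  simp only [ind_glue]

/-- **THE LETTER EXPANSION OF THE LATIN KERNEL** (all `κ`, arbitrary finsets): with `x_l = sec x l`,
`κ(a,b,c) = Σ_{τ ∈ S₃} [2·S1(a_{τ0}∩b_{τ0}∩c_{τ0}) − L(a_{τ0}, b_{τ1}∩c_{τ1}) − L(b_{τ0}, a_{τ1}∩c_{τ1}) − L(c_{τ0}, a_{τ1}∩b_{τ1})
 + L₃(a_{τ0}, b_{τ1}, c_{τ2})]`. [this work] -/
theorem kappa_option (a b c : Finset (Pt (Option κ))) :
    kappa a b c = ∑ τ : Equiv.Perm (Fin 3),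
      (2 * S1 (sec a (τ 0) ∩ sec b (τ 0) ∩ sec c (τ 0))
        - latinPairs (sec a (τ 0)) (sec b (τ 1) ∩ sec c (τ 1))
        - latinPairs (sec b (τ 0)) (sec a (τ 1) ∩ sec c (τ 1))
        - latinPairs (sec c (τ 0)) (sec a (τ 1) ∩ sec b (τ 1))
        + latinTriples (sec a (τ 0)) (sec b (τ 1)) (sec c (τ 2))) := by
  unfold kappa
  rw [sum_lperm_option (fun x y z => G a b c x y z)]
  refine sum_congr rfl fun τ _ => ?_
  simp only [G, ind_glue]
  unfold S1 latinPairs latinTriples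
  simp only [ind_inter, mul_sum, ← sum_sub_distrib, ← sum_add_distrib]

end Summit.CriticalPhenomena.PercolationContinuityZ3.Theorems.SahiLatin
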